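import Summits.QuantumFields.BalabanUV.Beta.GAN24.DressedLegUnits
import Summits.QuantumFields.BalabanUV.Beta.GAN24.AxProjBmWindow
import Summits.QuantumFields.BalabanUV.Beta.CoDressedMmRead

/-!
# `BalabanUV.Beta.D1BFx.RoadPinKernelBdd` — road «BF-x» for binder row D1, slot (K) ∕ junction (J1), PART 24 HEAD, «G0-BDD»: **THE BLOCK-MEAN CO-DRESSING
# `K ↦ Πᵀ_bm K Π_bm` COSTS AT MOST `(1 + 4(d+1)N)²` IN SUP NORM — `Bdd K S ⟹ Bdd (coDressKBmAt (toSite r) N K) ((1 + 4(d+1)N)²·S)` for ANY packed kernel and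
# any in-block root, hence the `hG : Bdd G₀ S` socket of EVERY tadpole row of the HEAD at `G₀ := coDressKBmAt (ctr 4 n) n (KInvStep 3 n 0)` with `S = (1 + 16n)²·S₀`,
# NO lattice volume and NO decay rate in the transport**

HONEST DEPENDENCY (cell records, verbatim): «continuum YM on T⁴ ⇐ BetaPertH ∧ nine spine estimates (0/9 proved); BetaPertH ⇐ (D1) ∧ (D4) ∧
CAP+tail; G-an2-4 gates asym, D1 and NE2/3/4.»  HONEST FRAMING (cell contract, verbatim): «discharging `BetaPertH` makes Bałaban's UV stability
UNCONDITIONAL — a real constructive-QFT result; it is NOT the continuum limit and NOT the Clay problem.»  THIS MODULE DISCHARGES NOTHING of the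
wall: [folklore] composition BY NAME of LANDED theorems — gan24-leaf-02's «the window matrix IS the projector» (`GAN24.AxProjBmWindow.axProjBmAt_eq_coProjBmW'`),
gan24's sup form of the block-mean-normalised rooted projector (`GAN24.DressedLegUnits.abs_axProjBmAt_le_of_sup`: `|Π^ρ_bm A| ≤ (1 + 4(d+1)N)·sup|A|`), an2's
window contraction `AxialDressingRooted.sum_piKBm_col_inl ∕ tsum_window' ∕ comp_piKBm_inr ∕ comp_trK_piKBm_inr`.  No definition, no `def … : Prop`, nothing cited,
NO printed hypothesis in §1, 0 sorry.  A SUP LETTER for a leg: it prices NO word and proves NO (1.22) row; `S₀` (the straight kernel's sup) stays DISPLAYED in §2;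
0 root-level binders of row D1 discharged (hW ∕ hR-sockets ∕ hSX-socket ∕ D1Tel ∕ D1Rep = 0); (J1) ONE OPEN ROW; (K) NOT closed; NOT D1, NEVER «G-an2-4 closed»,
NOT `BetaPertH`, NOT continuum, NOT Clay.

ABSOLUTE RULE (cell charter, verbatim): «No internally-minted statement may enter as a cited fact. Every hypothesis is either kernel-proved in
this package or a verbatim quotation of a PUBLISHED theorem with page reference. The manuscript(s) under audit are NOT citable for their own
disputed steps — they are the thing under adjudication; programme-internal (2001/route/tribunal) claims are never citable.»

WHY (the OWNER d1-p2 g25's OWNER-MEMO-g25: «PRICING SEATS per row … THE n-COUNT … m-uniformity»; d1-leaf-03 g33 W-2 l.55077: the (mcol)(ms) rows close «modulo EXACTLY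
g62's two displayed letters `Bdd G₀ S` … and `hΦ`»; this lineage's g62 F4 `StraightPinRestRow` and g63 `StraightPinRestRowMass` ((rest)): every tadpole row of the
HEAD multiplies by the leg's sup `S`).  The only `S` the tree offered so far is `bdd_of_decays` of g62's «G0-DECAY» `RoadPinKernelDecay.decays_G₀_record`, whose
`Decays`-transport (an2's `exists_decays_coDressKBmAt`, constants displayed) carries `|Fib 3|²·cPb·cPb·Zl 4 (δ₀∕2)·Zl 4 (δ₀∕4)` at the FINE rate
`δ₀ = min δΓ (min (κ′∕(4n)) (κ₀∕(4n)))` — two lattice volumes `≍ n⁴` each and two window constants `≍ n` each: `S ≍ n¹⁰·S₀`.  A SUP socket never needed the decay: the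
dressed entry is the windowed projector applied once per field leg to the straight kernel's legs, and `Π^ρ_bm A = A − grad (bmGaugeAt A)` is bounded in sup norm by
`1 + 4(d+1)N` (the block-mean tree gauge of a bounded form reads `≤ (d+1)N` letters and one block mean).  So `S = (1 + 16n)²·S₀ ≍ 289n²·S₀` at `d = 3`.

CONTENT.
* §1 [folklore, generic `d`, in-block root `r ∈ box (d+1) N`, `1 ≤ N`]: **`abs_coProjBmW_le_of_sup`** (`|coProjBmW (toSite r) N A κ u| ≤ (1 + 4(d+1)N)·S` if `|A| ≤ S`),
  **`comp_trK_piKBm_inl_eq_coProjBmW`** ∕ **`comp_piKBm_inl_eq_coProjBmW`** (left ∕ right dressing of a field leg = `coProjBmW` of that leg, folded window form, any root),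
  **`bdd_comp_trK_piKBm`** ∕ **`bdd_comp_piKBm`** (one dressing costs `1 + 4(d+1)N`), **`bdd_coDressKBmAt`** (`Bdd K S ⟹ Bdd (coDressKBmAt (toSite r) N K) ((1 + 4(d+1)N)²·S)`).
* §2 [our objects, `d = 3`, `[NeZero n]`, the pin `G₀ := coDressKBmAt (ctr 4 n) n (KInvStep 3 n 0)`]: **`bdd_G₀_of_bdd`** (`Bdd K₀ S₀ ⟹ Bdd G₀ ((1 + 4·(4·n))²·S₀)`),
  **`bdd_G₀_of_decays`** (`Decays K₀ C δ`, `0 ≤ δ` ⟹ `Bdd G₀ ((1 + 4·(4·n))²·C)` — the plug for g62's `decays_K₀_of_blocks` BY TERM: `C = CΓ + 2·(n⁵)⁻¹C₄e^{κ′} + CΦ(n⁵)⁻¹(n³)⁻¹e^{κ₀}`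
  modulo the ff letter `hΓ` and `hΦ`).
NOT HERE (honest): `S₀`'s own n-law (the ff block's sup `CΓ` is the (K)-wall's letter, displayed); the rows; m-uniformity of anything.
Unit `b2b-balaban-gan24-formalise-leaf-05` (gen 63), G-an2-4 swarm leaf prover 05, road «BF-x» supplier; INTENT-3 «G0-BDD» (journal).  Not in print; our bookkeeping.
No existing file touched.
-/

noncomputable section

open Finset
open scoped BigOperators
open Literature.MathematicalPhysics.QuantumFieldTheory
open Literature.MathematicalPhysics.QuantumFieldTheory.Balaban1983to89
open Literature.MathematicalPhysics.QuantumFieldTheory.Balaban1983to89.Beta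
open ExpKernelCalculus (Site MKer comp)
open AffineAveraging (Form1 box toSite)
open AveragingContoursRooted (ctr ctrOff ctrOff_mem_box)
open KernelWard (Bdd)
open OneStepResolventKernel (Fib)
open OneStepKernelFamily (KInvStep)
open Summit.QuantumFields.BalabanUV.Beta.TameKernelCalculus (trK)
open Summit.QuantumFields.BalabanUV.Beta.AxialProjectorBlockMean (axProjBmAt)
open Summit.QuantumFields.BalabanUV.Beta.AxialDressingRooted (pmBm cube piKBm coDressKBmAt coDressKBmAt_eq sum_piKBm_col_inl tsum_window'
  coProjBmW coProjBmW_apply comp_piKBm_inr comp_trK_piKBm_inr)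
open Summit.QuantumFields.BalabanUV.Beta.GAN24.AxProjBmWindow (axProjBmAt_eq_coProjBmW')
open Summit.QuantumFields.BalabanUV.Beta.GAN24.DressedLegUnits (abs_axProjBmAt_le_of_sup)

namespace Summit.QuantumFields.BalabanUV.Beta.D1BFx.RoadPinKernelBdd

/-! ## §1 The windowed projector in sup norm (generic `d`, in-block root) -/

section Generic

variable {d : ℕ} {N : ℕ} {r : Fin (d + 1) → ℕ}

/-- [folklore] **`Π_bm` IS BOUNDED IN SUP NORM BY `1 + 4(d+1)N`**: if `|A κ z| ≤ S` everywhere then `|coProjBmW (toSite r) N A κ u| ≤ (1 + 4(d+1)N)·S`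
(gan24-leaf-02's `AxProjBmWindow.axProjBmAt_eq_coProjBmW'` — the window matrix IS the projector — and gan24's `DressedLegUnits.abs_axProjBmAt_le_of_sup` BY NAME). -/
theorem abs_coProjBmW_le_of_sup (hN : 1 ≤ N) (hr : r ∈ box (d + 1) N) {A : Form1 (d + 1) ℝ} {S : ℝ} (hA : ∀ κ z, |A κ z| ≤ S)
    (κ : Fin (d + 1)) (u : Site (d + 1)) : |coProjBmW (toSite r) N A κ u| ≤ (1 + 4 * (((d : ℝ) + 1) * N)) * S := by
  rw [← axProjBmAt_eq_coProjBmW' hN hr A]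
  exact abs_axProjBmAt_le_of_sup hN hr hA κ u

/-- [folklore] **LEFT DRESSING OF A FIELD ROW IS `Π_bm` OF THE KERNEL's FIRST LEG** (folded window form; any root):
`(Πᵀ ∘ K) u′ z (inl κ′) b = coProjBmW ρ N (fun α p ↦ K p z (inl α) b) κ′ u′`. -/
theorem comp_trK_piKBm_inl_eq_coProjBmW (ρ : Site (d + 1)) (N : ℕ) (K : MKer (d + 1) (Fib d)) (u' z : Site (d + 1)) (κ' : Fin (d + 1)) (b : Fib d) :
    comp (trK (piKBm ρ N)) K u' z (Sum.inl κ') b = coProjBmW ρ N (fun α p => K p z (Sum.inl α) b) κ' u' := by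
  unfold ExpKernelCalculus.comp
  have h : ∀ p, ∑ g : Fib d, trK (piKBm ρ N) u' p (Sum.inl κ') g * K p z g b =
      if u' - p ∈ cube (d + 1) N then ∑ α : Fin (d + 1), pmBm ρ N κ' u' α p * K p z (Sum.inl α) b else 0 := by
    intro p
    have e : ∀ g : Fib d, trK (piKBm ρ N) u' p (Sum.inl κ') g = piKBm ρ N p u' g (Sum.inl κ') := fun g => rfl
    simp_rw [e]
    exact sum_piKBm_col_inl ρ N p u' κ' (fun g => K p z g b)
  simp_rw [h]
  rw [tsum_window', coProjBmW_apply]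

/-- [folklore] **RIGHT DRESSING OF A FIELD COLUMN IS `Π_bm` OF THE KERNEL's SECOND LEG** (folded window form; any root):
`(A ∘ Π) x z a (inl β′) = coProjBmW ρ N (fun β q ↦ A x q a (inl β)) β′ z`. -/
theorem comp_piKBm_inl_eq_coProjBmW (ρ : Site (d + 1)) (N : ℕ) (A : MKer (d + 1) (Fib d)) (x z : Site (d + 1)) (a : Fib d) (β' : Fin (d + 1)) :
    comp A (piKBm ρ N) x z a (Sum.inl β') = coProjBmW ρ N (fun β q => A x q a (Sum.inl β)) β' z := by
  unfold ExpKernelCalculus.comp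
  have h : ∀ q, ∑ g : Fib d, A x q a g * piKBm ρ N q z g (Sum.inl β') =
      if z - q ∈ cube (d + 1) N then ∑ β : Fin (d + 1), pmBm ρ N β' z β q * A x q a (Sum.inl β) else 0 := by
    intro q
    have e : ∀ g : Fib d, A x q a g * piKBm ρ N q z g (Sum.inl β') = piKBm ρ N q z g (Sum.inl β') * A x q a g := fun g => mul_comm _ _
    simp_rw [e]
    exact sum_piKBm_col_inl ρ N q z β' (fun g => A x q a g)
  simp_rw [h]
  rw [tsum_window', coProjBmW_apply]

/-- [folklore] **LEFT DRESSING COSTS AT MOST `1 + 4(d+1)N` IN SUP NORM**: `Bdd K S ⟹ Bdd (Πᵀ ∘ K) ((1 + 4(d+1)N)·S)` (in-block root; multiplier rows untouched —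
`comp_trK_piKBm_inr`). -/
theorem bdd_comp_trK_piKBm (hN : 1 ≤ N) (hr : r ∈ box (d + 1) N) {K : MKer (d + 1) (Fib d)} {S : ℝ} (hK : Bdd K S) :
    Bdd (comp (trK (piKBm (toSite r) N)) K) ((1 + 4 * (((d : ℝ) + 1) * N)) * S) := by
  have hS : 0 ≤ S := (abs_nonneg _).trans (hK 0 0 (Sum.inl 0) (Sum.inl 0))
  have hc : 1 ≤ 1 + 4 * (((d : ℝ) + 1) * N) := le_add_of_nonneg_right (by positivity)
  intro u' z a b
  rcases a with κ' | m
  · rw [comp_trK_piKBm_inl_eq_coProjBmW]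
    exact abs_coProjBmW_le_of_sup hN hr (A := fun α p => K p z (Sum.inl α) b) (fun α p => hK p z (Sum.inl α) b) κ' u'
  · rw [comp_trK_piKBm_inr]
    exact (hK u' z (Sum.inr m) b).trans (le_mul_of_one_le_left hS hc)

/-- [folklore] **RIGHT DRESSING COSTS AT MOST `1 + 4(d+1)N` IN SUP NORM**: `Bdd A S ⟹ Bdd (A ∘ Π) ((1 + 4(d+1)N)·S)` (in-block root; multiplier columns untouched —
an2's `comp_piKBm_inr`). -/
theorem bdd_comp_piKBm (hN : 1 ≤ N) (hr : r ∈ box (d + 1) N) {A : MKer (d + 1) (Fib d)} {S : ℝ} (hA : Bdd A S) :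
    Bdd (comp A (piKBm (toSite r) N)) ((1 + 4 * (((d : ℝ) + 1) * N)) * S) := by
  have hS : 0 ≤ S := (abs_nonneg _).trans (hA 0 0 (Sum.inl 0) (Sum.inl 0))
  have hc : 1 ≤ 1 + 4 * (((d : ℝ) + 1) * N) := le_add_of_nonneg_right (by positivity)
  intro x z a b
  rcases b with β' | m
  · rw [comp_piKBm_inl_eq_coProjBmW]
    exact abs_coProjBmW_le_of_sup hN hr (A := fun β q => A x q a (Sum.inl β)) (fun β q => hA x q a (Sum.inl β)) β' z
  · rw [comp_piKBm_inr]
    exact (hA x z a (Sum.inr m)).trans (le_mul_of_one_le_left hS hc)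

/-- [folklore] **«G0-BDD», GENERIC FORM: THE BLOCK-MEAN CO-DRESSING `K ↦ Πᵀ_bm K Π_bm` COSTS AT MOST `(1 + 4(d+1)N)²` IN SUP NORM** (in-block root, ANY packed kernel):
`Bdd K S ⟹ Bdd (coDressKBmAt (toSite r) N K) ((1 + 4(d+1)N)²·S)` — NO lattice volume `Zl`, NO decay rate: the field legs are read through the windowed projector
(`|pmBm| ≤ 1 + 4(d+1)N` is NOT summed over the window — the projector is `A ↦ A − grad (bmGaugeAt A)` and the block-mean tree gauge of a bounded form is
`≤ 2(d+1)N·sup`), the multiplier legs pass untouched. -/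
theorem bdd_coDressKBmAt (hN : 1 ≤ N) (hr : r ∈ box (d + 1) N) {K : MKer (d + 1) (Fib d)} {S : ℝ} (hK : Bdd K S) :
    Bdd (coDressKBmAt (toSite r) N K) ((1 + 4 * (((d : ℝ) + 1) * N)) ^ 2 * S) := by
  rw [coDressKBmAt_eq, sq, mul_assoc]
  exact bdd_comp_piKBm hN hr (bdd_comp_trK_piKBm hN hr hK)

end Generic

/-! ## §2 `d = 3`: the HEAD's pin `G₀ := coDressKBmAt (ctr 4 n) n (KInvStep 3 n 0)` -/

section Pin

variable (n : ℕ) [NeZero n]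

/-- [our object] **«G0-BDD» AT THE RECORD** (the `hG : Bdd G₀ S` socket of every tadpole row of the HEAD — (rest), (mcol), (ms), (lamf), (dd)): a sup letter `Bdd K₀ S₀` of the
STRAIGHT one-shot kernel gives `Bdd G₀ ((1 + 4·(4·n))²·S₀)` — the dressing costs `(1 + 16n)²`, nothing else.  (`S₀` DISPLAYED: e.g. `bdd_of_decays` of this lineage's g62
«G0-DECAY» `RoadPinKernelDecay.decays_K₀_of_blocks`, `S₀ = CΓ + 2·(n⁵)⁻¹C₄e^{κ′} + CΦ(n⁵)⁻¹(n³)⁻¹e^{κ₀}` modulo the ff letter `hΓ` and `hΦ` — against the `Decays`-transport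
constant `|Fib 3|²·cPb·cPb·Zl·Zl` of `decays_G₀_record` at the fine rate `δ₀∕4`, which a SUP socket never needed.) -/
theorem bdd_G₀_of_bdd {S₀ : ℝ} (hK₀ : Bdd (KInvStep (d := 3) n 0) S₀) :
    Bdd (coDressKBmAt (ctr 4 n) n (KInvStep (d := 3) n 0)) ((1 + 4 * (((3 : ℝ) + 1) * n)) ^ 2 * S₀) := by
  have hn : 1 ≤ n := Nat.one_le_iff_ne_zero.2 (NeZero.ne n)
  exact bdd_coDressKBmAt (d := 3) hn (ctrOff_mem_box hn) hK₀

/-- [our object] **«G0-BDD» FROM A `Decays` LETTER OF THE STRAIGHT KERNEL** (`0 ≤ δ`; lit `KernelWard.bdd_of_decays`): `Decays K₀ C δ ⟹ Bdd G₀ ((1 + 4·(4·n))²·C)` — the plug for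
g62's `RoadPinKernelDecay.decays_K₀_of_blocks` BY TERM (its `C = CΓ + 2·(n⁵)⁻¹C₄e^{κ′} + CΦ(n⁵)⁻¹(n³)⁻¹e^{κ₀}`, its rate irrelevant here). -/
theorem bdd_G₀_of_decays {C δ : ℝ} (hK₀ : ExpKernelCalculus.Decays (KInvStep (d := 3) n 0) C δ) (hδ : 0 ≤ δ) :
    Bdd (coDressKBmAt (ctr 4 n) n (KInvStep (d := 3) n 0)) ((1 + 4 * (((3 : ℝ) + 1) * n)) ^ 2 * C) :=
  bdd_G₀_of_bdd n (KernelWard.bdd_of_decays hK₀ hδ)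

end Pin

end Summit.QuantumFields.BalabanUV.Beta.D1BFx.RoadPinKernelBdd

end
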